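import Summits.QuantumFields.BalabanUV.Beta.GAN24.SigmaPairEnvelopeExit
import Summits.QuantumFields.BalabanUV.Beta.GAN24.SigmaPairSlotMomentsExitSame
import Summits.QuantumFields.BalabanUV.Beta.GAN24.LayerPushMoments

/-!
# `BalabanUV.Beta.GAN24.SigmaPairLayerPushExit` — binder row G-an2-4 ∕ (CONV-C), W-slot CT-W «WC-TL» ∕ «QR-LL», row (LT-Δ) part (LT-3) × the (S) row: **THE FROZEN TERM OF THE
# LAYER PUSH AGAINST THE σ-PAIR's exit⊗exit PROFILE — leaf-01 g63's `LayerPushMoments.abs_tsum_mul_le_of_moments` WITH ITS THREE PROFILE HYPOTHESES `hZ ∕ hM0 ∕ hP1`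
# DISCHARGED: at every level `k` modulo (W-γ)_k; AT LEVEL 0 WITH NO DISPLAYED PROFILE HYPOTHESIS (centred root, `Lc` odd, pin `cE = Lc^{d+1}`, all `cVH cΛ`, `α ≠ β`);
# `α = β` unconditional (the profile is zero)** (G-an2-4 formalisation swarm → CRUX TEAM (2), seat `b2b-balaban-gan24-formalise-leaf-02`, gen 59, INTENT 6)

NOT IN PRINT; OUR BOOKKEEPING ([folklore] composition BY NAME: leaf-01 g63 `LayerPushMoments.abs_tsum_mul_le_of_moments` (the second-order lattice Taylor bound under (M0_y) ∧ (Π_y)),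
this seat's `SigmaPairEnvelopeExit.exists_envelope_sigmaPair_exit_level` (hZ), `SigmaPairSlotMomentsExit.moments_sigmaPair_exit_of_ward_level ∕ _levelZero` (hM0 ∧ hP1),
`SigmaPairSlotMomentsExitSame.profiles_sigmaPair_exit_same_eq_zero_level`; 0 `def`, 0 cited fact, 0 `def … : Prop`, 0 sorry).  HONEST FRAMING (cell contract, verbatim): «discharging
`BetaPertH` makes Bałaban's UV stability UNCONDITIONAL — a real constructive-QFT result; it is NOT the continuum limit and NOT the Clay problem.»  HONEST DEPENDENCY (verbatim): «continuum
YM on T⁴ ⇐ BetaPertH ∧ nine spine estimates (0/9 proved); BetaPertH ⇐ (D1) ∧ (D4) ∧ CAP+tail; G-an2-4 gates asym, D1 and NE2/3/4.»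
* §1 **`exists_layerPush_bound_sigmaPair_exit_of_ward_level`** — centred root, `Lc` odd, all `cE cVH cΛ`, every `k y ν α β`; profiles bound by their defining equations; IF (W-γ)_k THEN
  `∃ B δ, 0 < δ ∧ 0 ≤ B ∧` for every smooth leg `F` (leaf-01's `hF ∕ hFb` with growth rate `κ < δ`): `|Σ'_e F e·Z_k e| ≤ σ·B·(8∕(δ−κ)²·Zl((δ−κ)∕4))` — the constant AND the
  linear Taylor terms of `F` integrate to zero against the σ-pair.
* §2 **`exists_layerPush_bound_sigmaPair_exit_levelZero`** — `k = 0`, pin `cE = Lc^{d+1}`, `α ≠ β`: the same with NO hypothesis on the profile.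
* §3 **`tsum_layerPush_sigmaPair_exit_same_eq_zero`** — `α = β`, any in-block root, every `k`: the frozen term is `0` outright.
READING.  For the σ-pair piece of the level-0 W-slot letter the (LT-3) frozen-term estimate holds as a theorem; the other first-order piece (`vertexOfM G_k (RM y)`) and the levels
`k ≥ 1` ((W-γ)_k) are NOT treated; asserts NO value of Bałaban's tables; NOTHING of (Q-R) ∕ (DL) ∕ the (LT) tower's composition ∕ «T2Shape» ∕ (hW, hWall); NEVER «G-an2-4 closed» as
(CONV-C); NOT D1, NOT `BetaPertH`, NOT continuum, NOT Clay.  2026-08-22.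
-/

noncomputable section

open Finset
open scoped BigOperators
open Literature.MathematicalPhysics.QuantumFieldTheory
open Literature.MathematicalPhysics.QuantumFieldTheory.Balaban1983to89
open Literature.MathematicalPhysics.QuantumFieldTheory.Balaban1983to89.Beta
open B12Sec2to5 (l1 l1_nonneg)
open ExpKernelCalculus (Site MKer comp Zl)
open AffineAveraging (box toSite)
open AveragingContours (blk)
open AveragingContoursRooted (ctrOff ctrOff_mem_box)
open OneStepResolventKernel (Fib)
open OneStepKernelFamily (KInvStep colH)
open SecondOrderResponse (colM dM)
open Summit.QuantumFields.BalabanUV.Beta.BorderedHessian (stepScale)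
open Summit.QuantumFields.BalabanUV.Beta.AxialDressingRooted (coDressKBmAt)
open Summit.QuantumFields.BalabanUV.Beta.SpineRooted (SpureRecAt M1At)
open Summit.QuantumFields.BalabanUV.Beta.KernelWardRelative (gaugeWt)
open Summit.QuantumFields.BalabanUV.Beta.GAN24.LayerPushMoments (abs_tsum_mul_le_of_moments)
open Summit.QuantumFields.BalabanUV.Beta.GAN24.SigmaPairEnvelopeExit (exists_envelope_sigmaPair_exit_level envelope_nonneg)
open Summit.QuantumFields.BalabanUV.Beta.GAN24.SigmaPairSlotMomentsExit (moments_sigmaPair_exit_of_ward_level moments_sigmaPair_exit_levelZero)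
open Summit.QuantumFields.BalabanUV.Beta.GAN24.SigmaPairSlotMomentsExitSame (profiles_sigmaPair_exit_same_eq_zero_level)

namespace Summit.QuantumFields.BalabanUV.Beta.GAN24.SigmaPairLayerPushExit

variable {d Lc : ℕ} [NeZero Lc]

/-! ## §1 Every level, modulo (W-γ)_k -/

/-- NOT IN PRINT; OUR BOOKKEEPING.  **THE (LT-3) FROZEN-TERM BOUND FOR THE σ-PAIR AT LEVEL `k`, MODULO (W-γ)_k** (centred root `ρ = toSite (ctrOff (d+1) Lc)`, `Lc` odd, all
`cE cVH cΛ`, every `k y ν α β`; `Vα ∕ Vend ∕ Qc` bound by their defining equations — instantiate `fun _ => rfl`): IF «`∀ y′, Qc y′ = 2·(stepScale_k·Lc^{d+1})·Vend y′`» THEN there are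
`B ≥ 0` and `δ > 0` such that for every `κ < δ`, `κ ≥ 0`, `σ ≥ 0`, `pF ≥ 0` and every leg `F` with leaf-01's unit second-difference envelope `hF` and growth envelope `hFb`:
`|Σ'_e F e·(Vα e − ½·(stepScale_k·Lc^{d+1})⁻¹·Qc e)| ≤ σ·B·(8∕(δ−κ)²·Zl_{d+1}((δ−κ)∕4))`. -/
theorem exists_layerPush_bound_sigmaPair_exit_of_ward_level (hLc : Odd Lc) (cE cVH cΛ : ℝ) (k : ℕ) (y : Site (d + 1)) (ν α β : Fin (d + 1))
    {Vα Vend Qc : Site (d + 1) → ℝ}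
    (hVα : ∀ y' : Site (d + 1), Vα y' =
        (1 / 2 : ℝ) *
          ((∑ κ : Fin (d + 1), ∑' u : Site (d + 1),
              colH (coDressKBmAt (toSite (ctrOff (d + 1) Lc)) Lc (KInvStep (d := d) Lc k)) Lc ν y' κ u
                * ((if y' = y then (1 / 2 : ℝ) else 0) - (if blk Lc u = y then (1 / 2 : ℝ) else 0))
                * ∑' xz : Site (d + 1) × Site (d + 1),
                    ((if xz.1 α % (Lc : ℤ) = (Lc : ℤ) - 1 then (1 : ℝ) else 0) * (if xz.2 β % (Lc : ℤ) = (Lc : ℤ) - 1 then (1 : ℝ) else 0))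
                      * SpureRecAt d Lc (toSite (ctrOff (d + 1) Lc)) cE cVH cΛ k κ u xz.1 xz.2 (Sum.inl α) (Sum.inl β))
            + ∑ ρ' : Fin (d + 1), ∑' w : Site (d + 1),
              colM (coDressKBmAt (toSite (ctrOff (d + 1) Lc)) Lc (KInvStep (d := d) Lc k)) Lc ν y' ρ' w
                * ((if y' = y then (1 / 2 : ℝ) else 0) - (if w = y then (1 / 2 : ℝ) else 0))
                * ∑' xz : Site (d + 1) × Site (d + 1),
                    ((if xz.1 α % (Lc : ℤ) = (Lc : ℤ) - 1 then (1 : ℝ) else 0) * (if xz.2 β % (Lc : ℤ) = (Lc : ℤ) - 1 then (1 : ℝ) else 0))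
                      * M1At d Lc (toSite (ctrOff (d + 1) Lc)) cΛ k ρ' w xz.1 xz.2 (Sum.inl α) (Sum.inl β)))
    (hVend : ∀ y' : Site (d + 1), Vend y' =
        (1 / 2 : ℝ) *
          ((∑ κ : Fin (d + 1), ∑' u : Site (d + 1),
              colH (coDressKBmAt (toSite (ctrOff (d + 1) Lc)) Lc (KInvStep (d := d) Lc k)) Lc ν y' κ u
                * ((if y' + Pi.single ν 1 = y then (1 / 2 : ℝ) else 0) - (if blk Lc (u + Pi.single κ 1) = y then (1 / 2 : ℝ) else 0))
                * ∑' xz : Site (d + 1) × Site (d + 1),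
                    ((if xz.1 α % (Lc : ℤ) = (Lc : ℤ) - 1 then (1 : ℝ) else 0) * (if xz.2 β % (Lc : ℤ) = (Lc : ℤ) - 1 then (1 : ℝ) else 0))
                      * SpureRecAt d Lc (toSite (ctrOff (d + 1) Lc)) cE cVH cΛ k κ u xz.1 xz.2 (Sum.inl α) (Sum.inl β))
            + ∑ ρ' : Fin (d + 1), ∑' w : Site (d + 1),
              colM (coDressKBmAt (toSite (ctrOff (d + 1) Lc)) Lc (KInvStep (d := d) Lc k)) Lc ν y' ρ' w
                * ((if y' + Pi.single ν 1 = y then (1 / 2 : ℝ) else 0) - (if w + Pi.single ρ' 1 = y then (1 / 2 : ℝ) else 0))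
                * ∑' xz : Site (d + 1) × Site (d + 1),
                    ((if xz.1 α % (Lc : ℤ) = (Lc : ℤ) - 1 then (1 : ℝ) else 0) * (if xz.2 β % (Lc : ℤ) = (Lc : ℤ) - 1 then (1 : ℝ) else 0))
                      * M1At d Lc (toSite (ctrOff (d + 1) Lc)) cΛ k ρ' w xz.1 xz.2 (Sum.inl α) (Sum.inl β)))
    (hQc : ∀ y' : Site (d + 1), Qc y' =
        (∑ κ : Fin (d + 1), ∑' u : Site (d + 1),
            (∑' x₂, ∑ κ₂, comp (coDressKBmAt (toSite (ctrOff (d + 1) Lc)) Lc (KInvStep (d := d) Lc k))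
                (dM (coDressKBmAt (toSite (ctrOff (d + 1) Lc)) Lc (KInvStep (d := d) Lc k)) Lc (SpureRecAt d Lc (toSite (ctrOff (d + 1) Lc)) cE cVH cΛ k) (M1At d Lc (toSite (ctrOff (d + 1) Lc)) cΛ k) ν y')
                u x₂ (Sum.inl κ) (Sum.inl κ₂) * gaugeWt Lc y κ₂ x₂)
              * ∑' xz : Site (d + 1) × Site (d + 1),
                  ((if xz.1 α % (Lc : ℤ) = (Lc : ℤ) - 1 then (1 : ℝ) else 0) * (if xz.2 β % (Lc : ℤ) = (Lc : ℤ) - 1 then (1 : ℝ) else 0))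
                    * SpureRecAt d Lc (toSite (ctrOff (d + 1) Lc)) cE cVH cΛ k κ u xz.1 xz.2 (Sum.inl α) (Sum.inl β)
          + ∑ ρ' : Fin (d + 1), ∑' w : Site (d + 1),
            (∑' x₂, ∑ κ₂, comp (coDressKBmAt (toSite (ctrOff (d + 1) Lc)) Lc (KInvStep (d := d) Lc k))
                (dM (coDressKBmAt (toSite (ctrOff (d + 1) Lc)) Lc (KInvStep (d := d) Lc k)) Lc (SpureRecAt d Lc (toSite (ctrOff (d + 1) Lc)) cE cVH cΛ k) (M1At d Lc (toSite (ctrOff (d + 1) Lc)) cΛ k) ν y')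
                ((Lc : ℤ) • w) x₂ (Sum.inr ρ') (Sum.inl κ₂) * gaugeWt Lc y κ₂ x₂)
              * ∑' xz : Site (d + 1) × Site (d + 1),
                  ((if xz.1 α % (Lc : ℤ) = (Lc : ℤ) - 1 then (1 : ℝ) else 0) * (if xz.2 β % (Lc : ℤ) = (Lc : ℤ) - 1 then (1 : ℝ) else 0))
                    * M1At d Lc (toSite (ctrOff (d + 1) Lc)) cΛ k ρ' w xz.1 xz.2 (Sum.inl α) (Sum.inl β)))
    (hW : ∀ y' : Site (d + 1), Qc y' = 2 * (stepScale d Lc k * (Lc : ℝ) ^ (d + 1)) * Vend y') :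
    ∃ B δ : ℝ, 0 < δ ∧ 0 ≤ B ∧ ∀ (κ σ pF : ℝ) (F : Site (d + 1) → ℝ), κ < δ → 0 ≤ κ → 0 ≤ σ → 0 ≤ pF →
      (∀ (p : Site (d + 1)) (i : Fin (d + 1)),
        |(F (p + Pi.single i 1) - F p) - (F (y + Pi.single i 1) - F y)| ≤ σ * l1 (p - y) * Real.exp (κ * l1 (p - y))) →
      (∀ e, |F e| ≤ pF * Real.exp (κ * l1 (e - y))) →
      |∑' e : Site (d + 1), F e * (Vα e - (1 / 2 : ℝ) * (stepScale d Lc k * (Lc : ℝ) ^ (d + 1))⁻¹ * Qc e)|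
        ≤ σ * B * (8 / (δ - κ) ^ 2 * Zl (d + 1) ((δ - κ) / 4)) := by
  have hLc1 : 1 ≤ Lc := hLc.pos
  have hr : ctrOff (d + 1) Lc ∈ box (d + 1) Lc := ctrOff_mem_box hLc1
  obtain ⟨B, δ, hδ, hZ⟩ := exists_envelope_sigmaPair_exit_level (d := d) hLc1 hr cE cVH cΛ k y ν α β
  have hM := moments_sigmaPair_exit_of_ward_level hLc cE cVH cΛ k y ν α β hVα hVend hQc hW
  have hZ' : ∀ e, |Vα e - (1 / 2 : ℝ) * (stepScale d Lc k * (Lc : ℝ) ^ (d + 1))⁻¹ * Qc e| ≤ B * Real.exp (-δ * l1 (e - y)) := fun e => by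
    rw [hVα e, hQc e]; exact hZ e
  refine ⟨B, δ, hδ, envelope_nonneg hZ', fun κ σ pF F hκδ hκ hσ hpF hF hFb => ?_⟩
  exact abs_tsum_mul_le_of_moments hκδ hκ hσ hpF hF hFb hZ' hM.1 hM.2

/-! ## §2 Level 0: no displayed profile hypothesis -/

/-- NOT IN PRINT; OUR BOOKKEEPING.  **THE (LT-3) FROZEN-TERM BOUND FOR THE LEVEL-0 σ-PAIR, NO DISPLAYED PROFILE HYPOTHESIS** (centred root, `Lc` odd, the residual tower's pin
`cE = Lc^{d+1}`, all `cVH cΛ`, `α ≠ β`, every `y ν`; profiles by their defining equations): `∃ B ≥ 0, δ > 0` such that for every admissible leg `F` (as in §1)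
`|Σ'_e F e·Z₀ e| ≤ σ·B·(8∕(δ−κ)²·Zl_{d+1}((δ−κ)∕4))` — `hZ` by `SigmaPairEnvelopeExit`, `hM0 ∧ hP1` by `SigmaPairSlotMomentsExit.moments_sigmaPair_exit_levelZero` (FILE F inside). -/
theorem exists_layerPush_bound_sigmaPair_exit_levelZero (hLc : Odd Lc) {cE : ℝ} (hcE : cE = (Lc : ℝ) ^ (d + 1)) (cVH cΛ : ℝ) (y : Site (d + 1)) (ν : Fin (d + 1))
    {α β : Fin (d + 1)} (hab : α ≠ β) {Vα Vend Qc : Site (d + 1) → ℝ}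
    (hVα : ∀ y' : Site (d + 1), Vα y' =
        (1 / 2 : ℝ) *
          ((∑ κ : Fin (d + 1), ∑' u : Site (d + 1),
              colH (coDressKBmAt (toSite (ctrOff (d + 1) Lc)) Lc (KInvStep (d := d) Lc 0)) Lc ν y' κ u
                * ((if y' = y then (1 / 2 : ℝ) else 0) - (if blk Lc u = y then (1 / 2 : ℝ) else 0))
                * ∑' xz : Site (d + 1) × Site (d + 1),
                    ((if xz.1 α % (Lc : ℤ) = (Lc : ℤ) - 1 then (1 : ℝ) else 0) * (if xz.2 β % (Lc : ℤ) = (Lc : ℤ) - 1 then (1 : ℝ) else 0))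
                      * SpureRecAt d Lc (toSite (ctrOff (d + 1) Lc)) cE cVH cΛ 0 κ u xz.1 xz.2 (Sum.inl α) (Sum.inl β))
            + ∑ ρ' : Fin (d + 1), ∑' w : Site (d + 1),
              colM (coDressKBmAt (toSite (ctrOff (d + 1) Lc)) Lc (KInvStep (d := d) Lc 0)) Lc ν y' ρ' w
                * ((if y' = y then (1 / 2 : ℝ) else 0) - (if w = y then (1 / 2 : ℝ) else 0))
                * ∑' xz : Site (d + 1) × Site (d + 1),
                    ((if xz.1 α % (Lc : ℤ) = (Lc : ℤ) - 1 then (1 : ℝ) else 0) * (if xz.2 β % (Lc : ℤ) = (Lc : ℤ) - 1 then (1 : ℝ) else 0))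
                      * M1At d Lc (toSite (ctrOff (d + 1) Lc)) cΛ 0 ρ' w xz.1 xz.2 (Sum.inl α) (Sum.inl β)))
    (hVend : ∀ y' : Site (d + 1), Vend y' =
        (1 / 2 : ℝ) *
          ((∑ κ : Fin (d + 1), ∑' u : Site (d + 1),
              colH (coDressKBmAt (toSite (ctrOff (d + 1) Lc)) Lc (KInvStep (d := d) Lc 0)) Lc ν y' κ u
                * ((if y' + Pi.single ν 1 = y then (1 / 2 : ℝ) else 0) - (if blk Lc (u + Pi.single κ 1) = y then (1 / 2 : ℝ) else 0))
                * ∑' xz : Site (d + 1) × Site (d + 1),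
                    ((if xz.1 α % (Lc : ℤ) = (Lc : ℤ) - 1 then (1 : ℝ) else 0) * (if xz.2 β % (Lc : ℤ) = (Lc : ℤ) - 1 then (1 : ℝ) else 0))
                      * SpureRecAt d Lc (toSite (ctrOff (d + 1) Lc)) cE cVH cΛ 0 κ u xz.1 xz.2 (Sum.inl α) (Sum.inl β))
            + ∑ ρ' : Fin (d + 1), ∑' w : Site (d + 1),
              colM (coDressKBmAt (toSite (ctrOff (d + 1) Lc)) Lc (KInvStep (d := d) Lc 0)) Lc ν y' ρ' w
                * ((if y' + Pi.single ν 1 = y then (1 / 2 : ℝ) else 0) - (if w + Pi.single ρ' 1 = y then (1 / 2 : ℝ) else 0))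
                * ∑' xz : Site (d + 1) × Site (d + 1),
                    ((if xz.1 α % (Lc : ℤ) = (Lc : ℤ) - 1 then (1 : ℝ) else 0) * (if xz.2 β % (Lc : ℤ) = (Lc : ℤ) - 1 then (1 : ℝ) else 0))
                      * M1At d Lc (toSite (ctrOff (d + 1) Lc)) cΛ 0 ρ' w xz.1 xz.2 (Sum.inl α) (Sum.inl β)))
    (hQc : ∀ y' : Site (d + 1), Qc y' =
        (∑ κ : Fin (d + 1), ∑' u : Site (d + 1),
            (∑' x₂, ∑ κ₂, comp (coDressKBmAt (toSite (ctrOff (d + 1) Lc)) Lc (KInvStep (d := d) Lc 0))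
                (dM (coDressKBmAt (toSite (ctrOff (d + 1) Lc)) Lc (KInvStep (d := d) Lc 0)) Lc (SpureRecAt d Lc (toSite (ctrOff (d + 1) Lc)) cE cVH cΛ 0) (M1At d Lc (toSite (ctrOff (d + 1) Lc)) cΛ 0) ν y')
                u x₂ (Sum.inl κ) (Sum.inl κ₂) * gaugeWt Lc y κ₂ x₂)
              * ∑' xz : Site (d + 1) × Site (d + 1),
                  ((if xz.1 α % (Lc : ℤ) = (Lc : ℤ) - 1 then (1 : ℝ) else 0) * (if xz.2 β % (Lc : ℤ) = (Lc : ℤ) - 1 then (1 : ℝ) else 0))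
                    * SpureRecAt d Lc (toSite (ctrOff (d + 1) Lc)) cE cVH cΛ 0 κ u xz.1 xz.2 (Sum.inl α) (Sum.inl β)
          + ∑ ρ' : Fin (d + 1), ∑' w : Site (d + 1),
            (∑' x₂, ∑ κ₂, comp (coDressKBmAt (toSite (ctrOff (d + 1) Lc)) Lc (KInvStep (d := d) Lc 0))
                (dM (coDressKBmAt (toSite (ctrOff (d + 1) Lc)) Lc (KInvStep (d := d) Lc 0)) Lc (SpureRecAt d Lc (toSite (ctrOff (d + 1) Lc)) cE cVH cΛ 0) (M1At d Lc (toSite (ctrOff (d + 1) Lc)) cΛ 0) ν y')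
                ((Lc : ℤ) • w) x₂ (Sum.inr ρ') (Sum.inl κ₂) * gaugeWt Lc y κ₂ x₂)
              * ∑' xz : Site (d + 1) × Site (d + 1),
                  ((if xz.1 α % (Lc : ℤ) = (Lc : ℤ) - 1 then (1 : ℝ) else 0) * (if xz.2 β % (Lc : ℤ) = (Lc : ℤ) - 1 then (1 : ℝ) else 0))
                    * M1At d Lc (toSite (ctrOff (d + 1) Lc)) cΛ 0 ρ' w xz.1 xz.2 (Sum.inl α) (Sum.inl β))) :
    ∃ B δ : ℝ, 0 < δ ∧ 0 ≤ B ∧ ∀ (κ σ pF : ℝ) (F : Site (d + 1) → ℝ), κ < δ → 0 ≤ κ → 0 ≤ σ → 0 ≤ pF →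
      (∀ (p : Site (d + 1)) (i : Fin (d + 1)),
        |(F (p + Pi.single i 1) - F p) - (F (y + Pi.single i 1) - F y)| ≤ σ * l1 (p - y) * Real.exp (κ * l1 (p - y))) →
      (∀ e, |F e| ≤ pF * Real.exp (κ * l1 (e - y))) →
      |∑' e : Site (d + 1), F e * (Vα e - (1 / 2 : ℝ) * (stepScale d Lc 0 * (Lc : ℝ) ^ (d + 1))⁻¹ * Qc e)|
        ≤ σ * B * (8 / (δ - κ) ^ 2 * Zl (d + 1) ((δ - κ) / 4)) := by
  have hLc1 : 1 ≤ Lc := hLc.pos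
  have hr : ctrOff (d + 1) Lc ∈ box (d + 1) Lc := ctrOff_mem_box hLc1
  obtain ⟨B, δ, hδ, hZ⟩ := exists_envelope_sigmaPair_exit_level (d := d) hLc1 hr cE cVH cΛ 0 y ν α β
  have hM := moments_sigmaPair_exit_levelZero hLc hcE cVH cΛ y ν hab hVα hVend hQc
  have hZ' : ∀ e, |Vα e - (1 / 2 : ℝ) * (stepScale d Lc 0 * (Lc : ℝ) ^ (d + 1))⁻¹ * Qc e| ≤ B * Real.exp (-δ * l1 (e - y)) := fun e => by
    rw [hVα e, hQc e]; exact hZ e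
  refine ⟨B, δ, hδ, envelope_nonneg hZ', fun κ σ pF F hκδ hκ hσ hpF hF hFb => ?_⟩
  exact abs_tsum_mul_le_of_moments hκδ hκ hσ hpF hF hFb hZ' hM.1 hM.2

/-! ## §3 Same direction: the frozen term vanishes -/

/-- NOT IN PRINT; OUR BOOKKEEPING.  **SAME DIRECTION `α = β`: THE FROZEN TERM IS ZERO** (any in-block root, all `cE cVH cΛ`, every `k y ν α`, every leg `F`): the σ-pair's profile
vanishes identically (`SigmaPairSlotMomentsExitSame`), so `Σ'_e F e·Z_k e = 0`. -/
theorem tsum_layerPush_sigmaPair_exit_same_eq_zero {r : Fin (d + 1) → ℕ} (hr : r ∈ box (d + 1) Lc) (cE cVH cΛ : ℝ) (k : ℕ) (y : Site (d + 1)) (ν α : Fin (d + 1))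
    (F : Site (d + 1) → ℝ) {Vα Qc : Site (d + 1) → ℝ}
    (hVα : ∀ y' : Site (d + 1), Vα y' =
        (1 / 2 : ℝ) *
          ((∑ κ : Fin (d + 1), ∑' u : Site (d + 1),
              colH (coDressKBmAt (toSite r) Lc (KInvStep (d := d) Lc k)) Lc ν y' κ u
                * ((if y' = y then (1 / 2 : ℝ) else 0) - (if blk Lc u = y then (1 / 2 : ℝ) else 0))
                * ∑' xz : Site (d + 1) × Site (d + 1),
                    ((if xz.1 α % (Lc : ℤ) = (Lc : ℤ) - 1 then (1 : ℝ) else 0) * (if xz.2 α % (Lc : ℤ) = (Lc : ℤ) - 1 then (1 : ℝ) else 0))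
                      * SpureRecAt d Lc (toSite r) cE cVH cΛ k κ u xz.1 xz.2 (Sum.inl α) (Sum.inl α))
            + ∑ ρ' : Fin (d + 1), ∑' w : Site (d + 1),
              colM (coDressKBmAt (toSite r) Lc (KInvStep (d := d) Lc k)) Lc ν y' ρ' w
                * ((if y' = y then (1 / 2 : ℝ) else 0) - (if w = y then (1 / 2 : ℝ) else 0))
                * ∑' xz : Site (d + 1) × Site (d + 1),
                    ((if xz.1 α % (Lc : ℤ) = (Lc : ℤ) - 1 then (1 : ℝ) else 0) * (if xz.2 α % (Lc : ℤ) = (Lc : ℤ) - 1 then (1 : ℝ) else 0))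
                      * M1At d Lc (toSite r) cΛ k ρ' w xz.1 xz.2 (Sum.inl α) (Sum.inl α)))
    (hQc : ∀ y' : Site (d + 1), Qc y' =
        (∑ κ : Fin (d + 1), ∑' u : Site (d + 1),
            (∑' x₂, ∑ κ₂, comp (coDressKBmAt (toSite r) Lc (KInvStep (d := d) Lc k))
                (dM (coDressKBmAt (toSite r) Lc (KInvStep (d := d) Lc k)) Lc (SpureRecAt d Lc (toSite r) cE cVH cΛ k) (M1At d Lc (toSite r) cΛ k) ν y')
                u x₂ (Sum.inl κ) (Sum.inl κ₂) * gaugeWt Lc y κ₂ x₂)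
              * ∑' xz : Site (d + 1) × Site (d + 1),
                  ((if xz.1 α % (Lc : ℤ) = (Lc : ℤ) - 1 then (1 : ℝ) else 0) * (if xz.2 α % (Lc : ℤ) = (Lc : ℤ) - 1 then (1 : ℝ) else 0))
                    * SpureRecAt d Lc (toSite r) cE cVH cΛ k κ u xz.1 xz.2 (Sum.inl α) (Sum.inl α)
          + ∑ ρ' : Fin (d + 1), ∑' w : Site (d + 1),
            (∑' x₂, ∑ κ₂, comp (coDressKBmAt (toSite r) Lc (KInvStep (d := d) Lc k))
                (dM (coDressKBmAt (toSite r) Lc (KInvStep (d := d) Lc k)) Lc (SpureRecAt d Lc (toSite r) cE cVH cΛ k) (M1At d Lc (toSite r) cΛ k) ν y')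
                ((Lc : ℤ) • w) x₂ (Sum.inr ρ') (Sum.inl κ₂) * gaugeWt Lc y κ₂ x₂)
              * ∑' xz : Site (d + 1) × Site (d + 1),
                  ((if xz.1 α % (Lc : ℤ) = (Lc : ℤ) - 1 then (1 : ℝ) else 0) * (if xz.2 α % (Lc : ℤ) = (Lc : ℤ) - 1 then (1 : ℝ) else 0))
                    * M1At d Lc (toSite r) cΛ k ρ' w xz.1 xz.2 (Sum.inl α) (Sum.inl α))) :
    ∑' e : Site (d + 1), F e * (Vα e - (1 / 2 : ℝ) * (stepScale d Lc k * (Lc : ℝ) ^ (d + 1))⁻¹ * Qc e) = 0 := by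
  have h := profiles_sigmaPair_exit_same_eq_zero_level hr cE cVH cΛ k y ν α hVα hQc
  have hZ : ∀ e, F e * (Vα e - (1 / 2 : ℝ) * (stepScale d Lc k * (Lc : ℝ) ^ (d + 1))⁻¹ * Qc e) = 0 := fun e => by
    rw [(h e).1, (h e).2]; ring
  simp only [hZ, tsum_zero]

end Summit.QuantumFields.BalabanUV.Beta.GAN24.SigmaPairLayerPushExit

end
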